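import Summits.QuantumFields.QCD.Theorems.HeatSlicedQuarksQuarkLoopCoefficientDefs

/-!
# Helper B for stub `stub_torusToPlane` (line `Sketch`, crux `QuarkLoopCoefficient`, item stmt-QuantumFields-16786): the abelian gauge classification on `ℤ⁴`

For unit-modulus complex link fields on `ℤ⁴` (the colour blocks of a Cartan-diagonal `SU(3)` field
pulled back to the universal cover):

* `exists_lineGauge`: on a line every unimodular `f : ℤ → ℂ` is a pure gauge,
  `f k = h k · conj (h (k+1))` with `|h| = 1`, `h 0 = 1` (ordered product from the origin);
* `ladder`: flatness slides an edge across a line (discrete Stokes on a ladder of plaquettes);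
* `exists_gauge_upTo`, `exists_gauge_of_flat`: a unimodular field all of whose plaquettes are
  trivial is a pure gauge, `r (z, μ) = g z · conj (g (z + e_μ))`, `|g| = 1` — the discrete Poincaré
  lemma `H¹(ℤ⁴; U(1)) = 0`, proved by building the axial gauge one direction at a time;
* `symLink_plaquette`: the plaquettes of the symmetric gauge `symLink q` are `e^{iq}` in the
  `(0,1)` plane (`e^{−iq}` in the `(1,0)` orientation) and `1` in every other plane;
* `exists_gauge_symLink`: hence every unimodular field with these plaquettes is a gauge transform
  of `symLink q`: `u (z, μ) = g z · symLink q (z, μ) · conj (g (z + e_μ))`.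

Elementary algebra; Mathlib + the Defs file only.
-/

noncomputable section

namespace Summit.QuantumFields.QCD.Cruxes.QuarkLoopCoefficient.Sketch.TorusToPlane

open Summit.QuantumFields.QCD.Theorems.QuarkLoopCoefficient
open Literature.MathematicalPhysics.QuantumLattice Literature.MathematicalPhysics.QuantumFieldTheory
open Literature.Probability.LatticeModels (Site TorusSite)
open scoped Matrix ComplexConjugate

/-! ### Pure gauge on a line -/

/-- On the line `ℤ`, every unit-modulus field is a pure gauge: there is a unit-modulus `h` with
`h 0 = 1` and `h (k+1) = h k · conj (f k)` (equivalently `f k = h k · conj (h (k+1))`): the ordered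
product of the links from the origin. -/
theorem exists_lineGauge (f : ℤ → ℂ) (hf : ∀ k, ‖f k‖ = 1) :
    ∃ h : ℤ → ℂ, h 0 = 1 ∧ (∀ k, ‖h k‖ = 1) ∧ ∀ k, h (k + 1) = h k * conj (f k) := by
  refine ⟨fun k => conj (∏ j ∈ Finset.range k.toNat, f j) *
      ∏ j ∈ Finset.range (-k).toNat, f (-((j : ℤ) + 1)), by simp, fun k => ?_, fun k => ?_⟩
  · simp only [norm_mul, RCLike.norm_conj, norm_prod, hf, Finset.prod_const_one, mul_one]
  · rcases le_or_gt 0 k with hk | hk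
    · -- `k ≥ 0`: one more factor in the first product
      obtain ⟨n, rfl⟩ := Int.eq_ofNat_of_zero_le hk
      have h1 : ((n : ℤ) + 1).toNat = n + 1 := by
        rw [show ((n : ℤ) + 1) = ((n + 1 : ℕ) : ℤ) by push_cast; ring, Int.toNat_natCast]
      have h2 : (-((n : ℤ) + 1)).toNat = 0 := Int.toNat_eq_zero.mpr (by omega)
      have h3 : (-(n : ℤ)).toNat = 0 := Int.toNat_eq_zero.mpr (by omega)
      simp only [Int.toNat_natCast, h1, h2, h3, Finset.prod_range_zero, mul_one,
        Finset.prod_range_succ, map_mul]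
    · -- `k < 0`: one factor fewer in the second product
      obtain ⟨m, hm⟩ := Int.eq_ofNat_of_zero_le (by omega : (0 : ℤ) ≤ -(k + 1))
      obtain rfl : k = -((m : ℤ) + 1) := by omega
      have h1 : (-((m : ℤ) + 1) + 1).toNat = 0 := Int.toNat_eq_zero.mpr (by omega)
      have h2 : (-((m : ℤ) + 1)).toNat = 0 := Int.toNat_eq_zero.mpr (by omega)
      have h3 : (-(-((m : ℤ) + 1))).toNat = m + 1 := by
        rw [neg_neg, show ((m : ℤ) + 1) = ((m + 1 : ℕ) : ℤ) by push_cast; ring, Int.toNat_natCast]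
      have h4 : (-(-((m : ℤ) + 1) + 1)).toNat = m := by
        rw [show (-(-((m : ℤ) + 1) + 1)) = (m : ℤ) by ring, Int.toNat_natCast]
      simp only [h1, h2, h3, h4, Finset.prod_range_zero, map_one, one_mul, Finset.prod_range_succ]
      rw [mul_assoc, Complex.mul_conj', hf]
      simp

/-! ### Sliding an edge across a line (discrete Stokes) -/

/-- **Ladder identity.** For a unimodular flat field `r` (flatness in product form) and line gauges
`h zf` along direction `κ` based at every site (`h zf (j+1) = h zf j · conj r(zf + j e_κ, κ)`,
`h zf 0 = 1`), the `μ`-edges along the `κ`-line through `zf` are transported by the two line gauges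
at `zf` and `zf + e_μ`: `r(zf + n e_κ, μ) = r(zf, μ) · h zf n · conj (h (zf + e_μ) n)`. -/
theorem ladder (r : LGConfig 4 ℂ) (hr : ∀ e, ‖r e‖ = 1)
    (hflat : ∀ (z : Site 4) (μ ν : Fin 4),
      r (z, μ) * r (z + Pi.single μ 1, ν) = r (z, ν) * r (z + Pi.single ν 1, μ))
    (κ μ : Fin 4) (h : Site 4 → ℤ → ℂ) (hh0 : ∀ zf, h zf 0 = 1)
    (hrec : ∀ (zf : Site 4) (j : ℤ), h zf (j + 1) = h zf j * conj (r (zf + Pi.single κ j, κ)))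
    (zf : Site 4) :
    ∀ n : ℤ, r (zf + Pi.single κ n, μ) = r (zf, μ) * (h zf n * conj (h (zf + Pi.single μ 1) n)) := by
  have hu : ∀ e, conj (r e) * r e = 1 := fun e => by rw [Complex.conj_mul', hr]; simp
  intro n
  induction n with
  | zero => simp [hh0]
  | succ i ih =>
    -- slide across the plaquette at `w = zf + i e_κ` in the `(μ, κ)` plane
    have hw : zf + Pi.single κ ((i : ℤ) + 1) = zf + Pi.single κ (i : ℤ) + Pi.single κ 1 := by
      rw [Pi.single_add, add_assoc]
    have hw' : zf + Pi.single μ 1 + Pi.single κ (i : ℤ) = zf + Pi.single κ (i : ℤ) + Pi.single μ 1 :=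
      add_right_comm _ _ _
    have hf := hflat (zf + Pi.single κ (i : ℤ)) μ κ
    rw [hw, hrec, hrec, hw', map_mul, Complex.conj_conj]
    -- `r(w + e_κ, μ) = conj r(w,κ) · (r(w,μ) r(w+e_μ,κ))`
    calc r (zf + Pi.single κ (i : ℤ) + Pi.single κ 1, μ)
        = conj (r (zf + Pi.single κ (i : ℤ), κ)) * (r (zf + Pi.single κ (i : ℤ), κ) *
            r (zf + Pi.single κ (i : ℤ) + Pi.single κ 1, μ)) := by rw [← mul_assoc, hu, one_mul]
      _ = conj (r (zf + Pi.single κ (i : ℤ), κ)) * (r (zf + Pi.single κ (i : ℤ), μ) *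
            r (zf + Pi.single κ (i : ℤ) + Pi.single μ 1, κ)) := by rw [hf]
      _ = _ := by rw [ih]; ring
  | pred i ih =>
    -- slide back across the plaquette at `w = zf + (-i-1) e_κ`
    have hw : zf + Pi.single κ (-(i : ℤ)) = zf + Pi.single κ (-(i : ℤ) - 1) + Pi.single κ 1 := by
      rw [add_assoc, ← Pi.single_add, sub_add_cancel]
    have hw' : zf + Pi.single μ 1 + Pi.single κ (-(i : ℤ) - 1) =
        zf + Pi.single κ (-(i : ℤ) - 1) + Pi.single μ 1 := add_right_comm _ _ _
    -- one step down the line gauges: `h(-i-1) = h(-i) · r(w, κ)`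
    have hdown : ∀ wf : Site 4, h wf (-(i : ℤ) - 1) =
        h wf (-(i : ℤ)) * r (wf + Pi.single κ (-(i : ℤ) - 1), κ) := by
      intro wf
      have hstep := hrec wf (-(i : ℤ) - 1)
      rw [sub_add_cancel] at hstep
      rw [hstep, mul_assoc, hu, mul_one]
    have hf := hflat (zf + Pi.single κ (-(i : ℤ) - 1)) μ κ
    rw [hw] at ih
    rw [hdown, hdown, hw', map_mul]
    -- `r(w, μ) = r(w,κ) r(w+e_κ,μ) conj r(w+e_μ,κ)`
    calc r (zf + Pi.single κ (-(i : ℤ) - 1), μ)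
        = r (zf + Pi.single κ (-(i : ℤ) - 1), μ) * r (zf + Pi.single κ (-(i : ℤ) - 1) + Pi.single μ 1, κ) *
            conj (r (zf + Pi.single κ (-(i : ℤ) - 1) + Pi.single μ 1, κ)) := by
          rw [mul_assoc, mul_comm (r _) (conj _), hu, mul_one]
      _ = r (zf + Pi.single κ (-(i : ℤ) - 1), κ) * r (zf + Pi.single κ (-(i : ℤ) - 1) + Pi.single κ 1, μ) *
            conj (r (zf + Pi.single κ (-(i : ℤ) - 1) + Pi.single μ 1, κ)) := by rw [hf]
      _ = _ := by rw [ih]; ring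

/-! ### The axial gauge, direction by direction -/

/-- **Axial gauge on the first `k` directions.** For a unimodular flat field `r` on `ℤ⁴` and `k ≤ 4`
there is a unit-modulus `g` with `r (z, μ) = g z · conj (g (z + e_μ))` for every direction `μ < k`
and every site `z` of the coordinate sublattice `z_i = 0 (i ≥ k)`. Induction on `k`: extend `g` along
direction `k` by the line gauges of `r(·, k)`, and slide the earlier directions by `ladder`. -/
theorem exists_gauge_upTo (r : LGConfig 4 ℂ) (hr : ∀ e, ‖r e‖ = 1)
    (hflat : ∀ (z : Site 4) (μ ν : Fin 4),
      r (z, μ) * r (z + Pi.single μ 1, ν) = r (z, ν) * r (z + Pi.single ν 1, μ)) :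
    ∀ k : ℕ, k ≤ 4 → ∃ g : Site 4 → ℂ, (∀ z, ‖g z‖ = 1) ∧
      ∀ z : Site 4, (∀ i : Fin 4, k ≤ (i : ℕ) → z i = 0) → ∀ μ : Fin 4, (μ : ℕ) < k →
        r (z, μ) = g z * conj (g (z + Pi.single μ 1))
  | 0, _ => ⟨fun _ => 1, fun _ => by simp, fun _ _ _ hμ => absurd hμ (Nat.not_lt_zero _)⟩
  | k + 1, hk => by
    obtain ⟨g, hg, hgauge⟩ := exists_gauge_upTo r hr hflat k (Nat.le_of_succ_le hk)
    have hk4 : k < 4 := hk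
    set κ : Fin 4 := ⟨k, hk4⟩ with hκ
    -- line gauges of `r(·, κ)` along direction `κ`, based at every site
    choose h hh0 hh1 hrec using fun zf : Site 4 =>
      exists_lineGauge (fun j : ℤ => r (zf + Pi.single κ j, κ)) fun j => hr _
    have hu1 : ∀ c : ℂ, ‖c‖ = 1 → c * conj c = 1 := fun c hc => by
      rw [Complex.mul_conj', hc]; simp
    -- the new gauge: old gauge at the foot `zf = z − z_κ e_κ` of the `κ`-line, times the line gauge
    refine ⟨fun z => g (z - Pi.single κ (z κ)) * h (z - Pi.single κ (z κ)) (z κ), fun z => by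
      rw [norm_mul, hg, hh1, one_mul], fun z hz μ hμ => ?_⟩
    have hfoot : z - Pi.single κ (z κ) + Pi.single κ (z κ) = z := sub_add_cancel _ _
    rcases Nat.lt_succ_iff_lt_or_eq.mp hμ with hlt | heq
    · -- an earlier direction `μ < k`: induction hypothesis at the foot, then the ladder
      have hμκ : μ ≠ κ := fun e => by rw [e] at hlt; exact lt_irrefl _ hlt
      have hc1 : (z + Pi.single μ 1 : Site 4) κ = z κ := by
        rw [Pi.add_apply, Pi.single_eq_of_ne (Ne.symm hμκ), add_zero]
      have hc2 : (z + Pi.single μ 1 - Pi.single κ (z κ) : Site 4) =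
          z - Pi.single κ (z κ) + Pi.single μ 1 := by
        abel
      simp only [hc1, hc2]
      -- the foot lies in the sublattice of the first `k` directions
      have hzf : ∀ i : Fin 4, k ≤ (i : ℕ) → (z - Pi.single κ (z κ) : Site 4) i = 0 := by
        intro i hi
        rcases Nat.eq_or_lt_of_le hi with h' | h'
        · have : i = κ := Fin.ext h'.symm
          rw [this, Pi.sub_apply, Pi.single_eq_same, sub_self]
        · have hiκ : i ≠ κ := fun e => by rw [e] at h'; exact lt_irrefl _ h'
          rw [Pi.sub_apply, Pi.single_eq_of_ne hiκ, sub_zero, hz i h']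
      have IH := hgauge (z - Pi.single κ (z κ)) hzf μ hlt
      have L := ladder r hr hflat κ μ h hh0 hrec (z - Pi.single κ (z κ)) (z κ)
      rw [hfoot] at L
      rw [L, IH, map_mul]
      ring
    · -- the new direction `μ = κ`: one more step of the line gauge
      have hμκ : μ = κ := Fin.ext heq
      subst hμκ
      have hc1 : (z + Pi.single κ 1 : Site 4) κ = z κ + 1 := by
        rw [Pi.add_apply, Pi.single_eq_same]
      have hc2 : (z + Pi.single κ 1 - Pi.single κ (z κ + 1) : Site 4) = z - Pi.single κ (z κ) := by
        rw [Pi.single_add]; abel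
      simp only [hc1, hc2]
      rw [hrec, hfoot, map_mul, map_mul, Complex.conj_conj]
      have e1 := hu1 _ (hg (z - Pi.single κ (z κ)))
      have e2 := hu1 _ (hh1 (z - Pi.single κ (z κ)) (z κ))
      linear_combination (-(r (z, κ))) * (h (z - Pi.single κ (z κ)) (z κ) *
        conj (h (z - Pi.single κ (z κ)) (z κ))) * e1 - r (z, κ) * e2

/-- **Discrete Poincaré lemma on `ℤ⁴` (`H¹(ℤ⁴; U(1)) = 0`).** A unit-modulus link field all of whose
plaquettes are trivial (flatness in product form `r(z,μ) r(z+e_μ,ν) = r(z,ν) r(z+e_ν,μ)`) is a pure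
gauge: `r (z, μ) = g z · conj (g (z + e_μ))` with `|g| = 1`. -/
theorem exists_gauge_of_flat (r : LGConfig 4 ℂ) (hr : ∀ e, ‖r e‖ = 1)
    (hflat : ∀ (z : Site 4) (μ ν : Fin 4),
      r (z, μ) * r (z + Pi.single μ 1, ν) = r (z, ν) * r (z + Pi.single ν 1, μ)) :
    ∃ g : Site 4 → ℂ, (∀ z, ‖g z‖ = 1) ∧
      ∀ (z : Site 4) (μ : Fin 4), r (z, μ) = g z * conj (g (z + Pi.single μ 1)) := by
  obtain ⟨g, hg, hgauge⟩ := exists_gauge_upTo r hr hflat 4 le_rfl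
  exact ⟨g, hg, fun z μ => hgauge z (fun i hi => absurd i.isLt (not_lt.mpr hi)) μ μ.isLt⟩

/-! ### The symmetric gauge has constant flux in the `(0,1)` plane -/

/-- **Plaquettes of the symmetric gauge.** `symLink q` has plaquette `e^{iq}` at every site in the
`(0,1)` plane, `e^{−iq}` in the opposite orientation `(1,0)`, and `1` in every other plane
(`A₀ = −z₁/2`, `A₁ = z₀/2`: the phase around the `(0,1)` plaquette is `q(½ + ½)`). -/
theorem symLink_plaquette (q : ℝ) (z : Site 4) (μ ν : Fin 4) :
    symLink q (z, μ) * symLink q (z + Pi.single μ 1, ν) * conj (symLink q (z + Pi.single ν 1, μ)) *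
        conj (symLink q (z, ν)) =
      if μ = 0 ∧ ν = 1 then Complex.exp (Complex.I * q)
      else if μ = 1 ∧ ν = 0 then Complex.exp (-(Complex.I * q)) else 1 := by
  have hconj : ∀ x : ℝ, conj (Complex.exp ((x : ℂ) * Complex.I)) = Complex.exp (((-x : ℝ) : ℂ) * Complex.I) := by
    intro x
    rw [← Complex.exp_conj, map_mul, Complex.conj_ofReal, Complex.conj_I]
    push_cast
    ring_nf
  rw [show (if μ = 0 ∧ ν = 1 then Complex.exp (Complex.I * q)
      else if μ = 1 ∧ ν = 0 then Complex.exp (-(Complex.I * q)) else (1 : ℂ)) =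
      Complex.exp (if μ = 0 ∧ ν = 1 then Complex.I * q
        else if μ = 1 ∧ ν = 0 then -(Complex.I * q) else 0) by
    split_ifs <;> simp]
  simp only [symLink, hconj, ← Complex.exp_add]
  congr 1
  fin_cases μ <;> fin_cases ν <;> simp [symPotential] <;> ring

/-- The symmetric-gauge links have modulus one. -/
theorem norm_symLink_eq_one (q : ℝ) (e : ZdEdge 4) : ‖symLink q e‖ = 1 :=
  Complex.norm_exp_ofReal_mul_I _

/-- **Gauge classification.** A unit-modulus link field on `ℤ⁴` with the plaquettes of the symmetric
gauge of flux `q` (`e^{iq}` in the `(0,1)` plane, `e^{−iq}` in the `(1,0)` orientation, `1` otherwise)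
is a gauge transform of `symLink q`: `u (z, μ) = g z · symLink q (z, μ) · conj (g (z + e_μ))` with
`|g| = 1` (apply the Poincaré lemma to the flat unimodular ratio `u · conj (symLink q)`). -/
theorem exists_gauge_symLink (u : LGConfig 4 ℂ) (q : ℝ) (hu : ∀ e, ‖u e‖ = 1)
    (hP : ∀ (z : Site 4) (μ ν : Fin 4),
      u (z, μ) * u (z + Pi.single μ 1, ν) * conj (u (z + Pi.single ν 1, μ)) * conj (u (z, ν)) =
        if μ = 0 ∧ ν = 1 then Complex.exp (Complex.I * q)
        else if μ = 1 ∧ ν = 0 then Complex.exp (-(Complex.I * q)) else 1) :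
    ∃ g : Site 4 → ℂ, (∀ z, ‖g z‖ = 1) ∧
      u = fun e => g e.1 * symLink q e * conj (g (e.1 + Pi.single e.2 1)) := by
  have hs := norm_symLink_eq_one q
  have hu1 : ∀ c : ℂ, ‖c‖ = 1 → c * conj c = 1 := fun c hc => by
    rw [Complex.mul_conj', hc]; simp
  obtain ⟨g, hg, hgauge⟩ := exists_gauge_of_flat (fun e => u e * conj (symLink q e))
    (fun e => by rw [norm_mul, RCLike.norm_conj, hu, hs, mul_one]) (by
      intro z μ ν
      have e1 := (hP z μ ν).trans (symLink_plaquette q z μ ν).symm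
      have n3 := hu1 _ (hu (z + Pi.single ν 1, μ))
      have n4 := hu1 _ (hu (z, ν))
      have m1 := hu1 _ (hs (z, μ))
      have m2 := hu1 _ (hs (z + Pi.single μ 1, ν))
      linear_combination (u (z + Pi.single ν 1, μ) * u (z, ν) * conj (symLink q (z, μ)) *
          conj (symLink q (z + Pi.single μ 1, ν))) * e1 -
        u (z, μ) * u (z + Pi.single μ 1, ν) * conj (symLink q (z, μ)) *
          conj (symLink q (z + Pi.single μ 1, ν)) * (u (z, ν) * conj (u (z, ν))) * n3 -
        u (z, μ) * u (z + Pi.single μ 1, ν) * conj (symLink q (z, μ)) *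
          conj (symLink q (z + Pi.single μ 1, ν)) * n4 +
        u (z + Pi.single ν 1, μ) * u (z, ν) * conj (symLink q (z + Pi.single ν 1, μ)) *
          conj (symLink q (z, ν)) * (symLink q (z + Pi.single μ 1, ν) *
            conj (symLink q (z + Pi.single μ 1, ν))) * m1 +
        u (z + Pi.single ν 1, μ) * u (z, ν) * conj (symLink q (z + Pi.single ν 1, μ)) *
          conj (symLink q (z, ν)) * m2)
  refine ⟨g, hg, funext fun e => ?_⟩
  obtain ⟨z, μ⟩ := e
  have hzμ := hgauge z μ
  have m := hu1 _ (hs (z, μ))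
  rw [mul_comm] at m
  linear_combination (symLink q (z, μ)) * hzμ - u (z, μ) * m

/-! ### Registered headline -/

/-- Registered headline of this helper file (aux stub `stub_torusToPlaneAuxB` of crux
stmt-QuantumFields-16786, line `Sketch`): the abelian gauge classification on `ℤ⁴` — a unimodular
link field with the plaquettes of the symmetric gauge of flux `q` is a gauge transform of `symLink q`. -/
theorem stub_torusToPlaneAuxB :
    ∀ (u : LGConfig 4 ℂ) (q : ℝ), (∀ e, ‖u e‖ = 1) →
      (∀ (z : Site 4) (μ ν : Fin 4),
        u (z, μ) * u (z + Pi.single μ 1, ν) * conj (u (z + Pi.single ν 1, μ)) * conj (u (z, ν)) =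
          if μ = 0 ∧ ν = 1 then Complex.exp (Complex.I * q)
          else if μ = 1 ∧ ν = 0 then Complex.exp (-(Complex.I * q)) else 1) →
      ∃ g : Site 4 → ℂ, (∀ z, ‖g z‖ = 1) ∧
        u = fun e => g e.1 * symLink q e * conj (g (e.1 + Pi.single e.2 1)) :=
  fun u q hu hP => exists_gauge_symLink u q hu hP

end Summit.QuantumFields.QCD.Cruxes.QuarkLoopCoefficient.Sketch.TorusToPlane

end
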